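import Summits.CriticalPhenomena.PercolationContinuityZ3.Theorems.PercNearOneGluingNoHeavyConstsSingleEdgeChainRule
import Literature.Probability.Percolation.TwoSetExchange
import Mathlib.LinearAlgebra.Matrix.Determinant.Basic
import HarnessLib
import HarnessLib.Audit.Tags

/-!
# The single-edge chain rule is the sign of a `3 × 3` minor of the symmetric DISCONNECTION KERNEL
# `K(S,T) = P(S ↮ T)`; reverse regularity of order two of that kernel (PAPER-2 track (ii), constants of the CSH family)

builds on p205010 (kernel theorem, internal audit signed; external expert review pending).  Support file (`--supports
stmt-CriticalPhenomena-4575`), seat `prim-consts-2` (gen 4); rows A6/A11 of `run/shared/lean/prim/consts/CONSTANTS.md`; memo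
`run/shared/lean/prim/consts/FROM-prim-consts-2-g4-BERNSTEIN.md`.  No definitions, no sorries; standard axioms.

For a finite weighted graph (`μ = prodBernoulli w`) and vertex sets `S, T` write `K(S,T) = μ{S ↮ T} = μ{∀ s ∈ S, ∀ t ∈ T, s ↮ t}`
(the disconnection kernel; symmetric in `S, T`, antitone in each argument).  With the chain-rule data `x, u, v, o, Y` of
`Consts.SingleEdgeChainRule` (sources `S₁ = {x} ⊂ S₂ = {x,u} ⊂ S₃ = {x,u,v}`, avoided set `Y`, targets `o, v`) one has
`μ(R_i) = K(S_i, Y)`, `μ(N_i) = K(S_i, Y ∪ {v})`, `μ(A_i) = K(S_i, Y) − K(S_i, Y ∪ {o})`, and `K(S₃, Y ∪ {v}) = 0`; substituting,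

* `Consts.singleEdgeChainRule_slack_eq_det` — **IDENTITY**: (right side − left side of the chain-rule inequality)
  `= det [K(S_i, T_j)]_{i,j}` with the columns `T₁ = Y ∪ {v}`, `T₂ = Y`, `T₃ = Y ∪ {o}`.  Hence
* `Consts.singleEdgeChainRule_iff_det_nonneg` — the conjecture `Consts.SingleEdgeChainRule` is EQUIVALENT to: for all finite weighted
  graphs and all `x, u, v, o, Y`, the `3 × 3` minor of the disconnection kernel with rows `({x}, {x,u}, {x,u,v})` and columns
  `(Y ∪ {v}, Y, Y ∪ {o})` is `≥ 0`.
* `Consts.disconnect_rr2` — **THEOREM (reverse regularity of order 2 on chains)**: for `S₁ ⊆ S₂`, `T₁ ⊆ T₂`,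
  `K(S₁,T₁) · K(S₂,T₂) ≤ K(S₁,T₂) · K(S₂,T₁)`, i.e. every `2 × 2` minor of `K` along a pair of chains is `≤ 0`
  (`P(S₂ ↮ T₂ ∣ S₂ ↮ T₁) ≤ P(S₁ ↮ T₂ ∣ S₁ ↮ T₁)`).  Proof: given `D = {S₁ ↮ T₁}` the event `{T₁ ↮ S₂}` is of type `(+)` and
  `{S₁ ↮ T₂}` of type `(−)` for the pair of cluster unions `(C_{S₁}, C_{T₁})`, so they are negatively correlated on `D` by the set form of
  van den Berg–Häggström–Kahn's Theorem 1.5 (`setTwoClusterExchange`), and `{S₂ ↮ T₂} ⊆ D ∩ {T₁ ↮ S₂} ∩ {S₁ ↮ T₂}`.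

So the open chain rule (⟺ single-edge extremality on cylinder functionals) is an ORDER-3 sign condition on a kernel whose ORDER-2
sign conditions are van den Berg–Häggström–Kahn's theorems (log-supermodularity in each argument = Thm 1.1 with `A = B = Ω`;
`disconnect_rr2` = Thm 1.5).  The rows form a chain ending with `+v`, the columns a "V" (`Y ⊂ Y∪v`, `Y ⊂ Y∪o`); the `(3,1)` entry vanishes.
[cite: VandenbergHaggstromKahn2005, Thm. 1.5 (p. 7), Thm. 2.1 (p. 9), Thm. 1.1 (pp. 3–5)]
-/

noncomputable section

namespace Summit.CriticalPhenomena.PercolationContinuityZ3.Theorems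

open MeasureTheory Set Literature.Probability.LatticeModels Literature.Probability.Percolation
open scoped Classical

namespace Consts

variable {V : Type*} [Fintype V]

/-- **Reverse regularity of order 2 of the disconnection kernel on chains.**  For vertex sets `S₁ ⊆ S₂` and `T₁ ⊆ T₂` of a finite
weighted graph, `μ{S₁ ↮ T₁} · μ{S₂ ↮ T₂} ≤ μ{S₁ ↮ T₂} · μ{S₂ ↮ T₁}`.  From the set form of van den Berg–Häggström–Kahn's Theorem 1.5
(`setTwoClusterExchange`): on `{S₁ ↮ T₁}` the events `{T₁ ↮ S₂}` (type `(+)`) and `{S₁ ↮ T₂}` (type `(−)`) are negatively correlated.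
[cite: VandenbergHaggstromKahn2005, Thm. 2.1 (p. 9) at q = 1, Thm. 1.5 (p. 7)] -/
theorem disconnect_rr2 (w : Sym2 V → unitInterval) {S₁ S₂ T₁ T₂ : Set V} (hS : S₁ ⊆ S₂) (hT : T₁ ⊆ T₂) :
    (prodBernoulli w).real {ω : BondConfig V | ∀ s ∈ S₁, ∀ t ∈ T₁, ¬ (openGraph ω).Reachable s t} *
        (prodBernoulli w).real {ω : BondConfig V | ∀ s ∈ S₂, ∀ t ∈ T₂, ¬ (openGraph ω).Reachable s t} ≤
      (prodBernoulli w).real {ω : BondConfig V | ∀ s ∈ S₁, ∀ t ∈ T₂, ¬ (openGraph ω).Reachable s t} *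
        (prodBernoulli w).real {ω : BondConfig V | ∀ s ∈ S₂, ∀ t ∈ T₁, ¬ (openGraph ω).Reachable s t} := by
  classical
  set μ := prodBernoulli w with hμ
  set D : Set (BondConfig V) := {ω | ∀ s ∈ S₁, ∀ t ∈ T₁, ¬ (openGraph ω).Reachable s t} with hD
  -- `P = {T₁ ↮ S₂}` (type `(+)`), `M = {S₁ ↮ T₂}` (type `(−)`)
  set P : Set (BondConfig V) := ⋂ s ∈ S₂, (⋃ t ∈ T₁, (openConn t s : Set (BondConfig V)))ᶜ with hP
  set M : Set (BondConfig V) := ⋂ t ∈ T₂, (⋃ s ∈ S₁, (openConn s t : Set (BondConfig V)))ᶜ with hM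
  have hPtype : ∀ ⦃ω ω' : BondConfig V⦄, (⋃ s ∈ S₁, openEdgeCluster ω s) ⊆ (⋃ s ∈ S₁, openEdgeCluster ω' s) →
      (⋃ t ∈ T₁, openEdgeCluster ω' t) ⊆ (⋃ t ∈ T₁, openEdgeCluster ω t) → ω ∈ P → ω' ∈ P := by
    intro ω ω' hs ht hω
    simp only [hP, mem_iInter] at hω ⊢
    intro s hs2
    exact TwoSetExchange.typePlus_not_biUnion_openConn S₁ T₁ s hs ht (hω s hs2)
  have hMtype : ∀ ⦃ω ω' : BondConfig V⦄, (⋃ s ∈ S₁, openEdgeCluster ω' s) ⊆ (⋃ s ∈ S₁, openEdgeCluster ω s) →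
      (⋃ t ∈ T₁, openEdgeCluster ω t) ⊆ (⋃ t ∈ T₁, openEdgeCluster ω' t) → ω ∈ M → ω' ∈ M := by
    intro ω ω' hs ht hω
    simp only [hM, mem_iInter] at hω ⊢
    intro t ht2
    exact TwoSetExchange.typeMinus_not_biUnion_openConn S₁ T₁ t hs ht (hω t ht2)
  have huniv : ∀ ⦃ω ω' : BondConfig V⦄, (⋃ s ∈ S₁, openEdgeCluster ω s) ⊆ (⋃ s ∈ S₁, openEdgeCluster ω' s) →
      (⋃ t ∈ T₁, openEdgeCluster ω' t) ⊆ (⋃ t ∈ T₁, openEdgeCluster ω t) → ω ∈ (univ : Set (BondConfig V)) →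
      ω' ∈ (univ : Set (BondConfig V)) := fun _ _ _ _ _ => mem_univ _
  have huniv' : ∀ ⦃ω ω' : BondConfig V⦄, (⋃ s ∈ S₁, openEdgeCluster ω' s) ⊆ (⋃ s ∈ S₁, openEdgeCluster ω s) →
      (⋃ t ∈ T₁, openEdgeCluster ω t) ⊆ (⋃ t ∈ T₁, openEdgeCluster ω' t) → ω ∈ (univ : Set (BondConfig V)) →
      ω' ∈ (univ : Set (BondConfig V)) := fun _ _ _ _ _ => mem_univ _
  have key := setTwoClusterExchange w S₁ T₁ (A₁ := P) (A₂ := univ) (B₁ := M) (B₂ := univ) hPtype huniv hMtype huniv'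
  simp only [inter_univ] at key
  -- key : μ.real (D ∩ (P ∩ M)) * μ.real D ≤ μ.real (D ∩ P) * μ.real (D ∩ M)
  -- identify the four sets
  have hDP : D ∩ P = {ω : BondConfig V | ∀ s ∈ S₂, ∀ t ∈ T₁, ¬ (openGraph ω).Reachable s t} := by
    ext ω
    simp only [hD, hP, mem_inter_iff, mem_setOf_eq, mem_iInter, mem_compl_iff, mem_iUnion, not_exists, openConn]
    constructor
    · rintro ⟨-, h2⟩ s hs t ht hst
      exact h2 s hs t ht hst.symm
    · intro h
      exact ⟨fun s hs t ht => h s (hS hs) t ht, fun s hs t ht hts => h s hs t ht hts.symm⟩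
  have hDM : D ∩ M = {ω : BondConfig V | ∀ s ∈ S₁, ∀ t ∈ T₂, ¬ (openGraph ω).Reachable s t} := by
    ext ω
    simp only [hD, hM, mem_inter_iff, mem_setOf_eq, mem_iInter, mem_compl_iff, mem_iUnion, not_exists, openConn]
    constructor
    · rintro ⟨-, h2⟩ s hs t ht hst
      exact h2 t ht s hs hst
    · intro h
      exact ⟨fun s hs t ht => h s hs t (hT ht), fun t ht s hs hst => h s hs t ht hst⟩
  have hsub : {ω : BondConfig V | ∀ s ∈ S₂, ∀ t ∈ T₂, ¬ (openGraph ω).Reachable s t} ⊆ D ∩ (P ∩ M) := by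
    intro ω h
    simp only [mem_setOf_eq] at h
    refine ⟨fun s hs t ht => h s (hS hs) t (hT ht), ?_, ?_⟩
    · simp only [hP, mem_iInter, mem_compl_iff, mem_iUnion, not_exists, openConn, mem_setOf_eq]
      exact fun s hs t ht hts => h s hs t (hT ht) hts.symm
    · simp only [hM, mem_iInter, mem_compl_iff, mem_iUnion, not_exists, openConn, mem_setOf_eq]
      exact fun t ht s hs hst => h s (hS hs) t ht hst
  have hmono : μ.real {ω : BondConfig V | ∀ s ∈ S₂, ∀ t ∈ T₂, ¬ (openGraph ω).Reachable s t} ≤ μ.real (D ∩ (P ∩ M)) :=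
    measureReal_mono hsub
  have hDnn : 0 ≤ μ.real D := measureReal_nonneg
  rw [hDP, hDM] at key
  calc μ.real D * μ.real {ω : BondConfig V | ∀ s ∈ S₂, ∀ t ∈ T₂, ¬ (openGraph ω).Reachable s t}
      ≤ μ.real D * μ.real (D ∩ (P ∩ M)) := mul_le_mul_of_nonneg_left hmono hDnn
    _ = μ.real (D ∩ (P ∩ M)) * μ.real D := mul_comm _ _
    _ ≤ μ.real {ω : BondConfig V | ∀ s ∈ S₂, ∀ t ∈ T₁, ¬ (openGraph ω).Reachable s t} *
        μ.real {ω : BondConfig V | ∀ s ∈ S₁, ∀ t ∈ T₂, ¬ (openGraph ω).Reachable s t} := key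
    _ = _ := mul_comm _ _

/-- **IDENTITY — the chain-rule slack is a `3 × 3` minor of the disconnection kernel.**  For every finite weighted graph and all
`x, u, v, o, Y`: (right side) − (left side) of the inequality of `Consts.SingleEdgeChainRule` equals
`det [μ{S_i ↮ T_j}]_{i,j ≤ 3}` with rows `S = ({x}, {x,u}, {x,u,v})` and columns `T = (Y ∪ {v}, Y, Y ∪ {o})`
(`μ(R_i) = K(S_i,Y)`, `μ(N_i) = K(S_i, Y ∪ v)`, `μ(A_i) = K(S_i,Y) − K(S_i, Y ∪ o)`, `K(S₃, Y ∪ v) = 0`; then expand along the third row).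
[cite: VandenbergHaggstromKahn2005, Thm. 1.1 (pp. 3–5)] -/
theorem singleEdgeChainRule_slack_eq_det (w : Sym2 V → unitInterval) (x u v o : V) (Y : Set V) :
    (prodBernoulli w).real ({ω : BondConfig V | ∀ y ∈ Y, ¬ (openGraph ω).Reachable x y ∧ ¬ (openGraph ω).Reachable u y} ∩
          {ω | ¬ (openGraph ω).Reachable x v ∧ ¬ (openGraph ω).Reachable u v}) *
        ((prodBernoulli w).real
              ({ω : BondConfig V | ∀ y ∈ Y, ¬ (openGraph ω).Reachable x y ∧ ¬ (openGraph ω).Reachable u y ∧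
                  ¬ (openGraph ω).Reachable v y} ∩ (openConn x o ∪ openConn u o ∪ openConn v o)) *
            (prodBernoulli w).real {ω : BondConfig V | ∀ y ∈ Y, ¬ (openGraph ω).Reachable x y} -
          (prodBernoulli w).real ({ω : BondConfig V | ∀ y ∈ Y, ¬ (openGraph ω).Reachable x y} ∩ openConn x o) *
            (prodBernoulli w).real
              {ω : BondConfig V | ∀ y ∈ Y, ¬ (openGraph ω).Reachable x y ∧ ¬ (openGraph ω).Reachable u y ∧
                ¬ (openGraph ω).Reachable v y}) -
      (prodBernoulli w).real ({ω : BondConfig V | ∀ y ∈ Y, ¬ (openGraph ω).Reachable x y} ∩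
          {ω | ¬ (openGraph ω).Reachable x v}) *
        ((prodBernoulli w).real
              ({ω : BondConfig V | ∀ y ∈ Y, ¬ (openGraph ω).Reachable x y ∧ ¬ (openGraph ω).Reachable u y ∧
                  ¬ (openGraph ω).Reachable v y} ∩ (openConn x o ∪ openConn u o ∪ openConn v o)) *
            (prodBernoulli w).real
              {ω : BondConfig V | ∀ y ∈ Y, ¬ (openGraph ω).Reachable x y ∧ ¬ (openGraph ω).Reachable u y} -
          (prodBernoulli w).real
              ({ω : BondConfig V | ∀ y ∈ Y, ¬ (openGraph ω).Reachable x y ∧ ¬ (openGraph ω).Reachable u y} ∩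
                (openConn x o ∪ openConn u o)) *
            (prodBernoulli w).real
              {ω : BondConfig V | ∀ y ∈ Y, ¬ (openGraph ω).Reachable x y ∧ ¬ (openGraph ω).Reachable u y ∧
                ¬ (openGraph ω).Reachable v y}) =
    Matrix.det !![
      (prodBernoulli w).real {ω : BondConfig V | ∀ s ∈ ({x} : Set V), ∀ t ∈ insert v Y, ¬ (openGraph ω).Reachable s t},
      (prodBernoulli w).real {ω : BondConfig V | ∀ s ∈ ({x} : Set V), ∀ t ∈ Y, ¬ (openGraph ω).Reachable s t},
      (prodBernoulli w).real {ω : BondConfig V | ∀ s ∈ ({x} : Set V), ∀ t ∈ insert o Y, ¬ (openGraph ω).Reachable s t};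
      (prodBernoulli w).real {ω : BondConfig V | ∀ s ∈ ({x, u} : Set V), ∀ t ∈ insert v Y, ¬ (openGraph ω).Reachable s t},
      (prodBernoulli w).real {ω : BondConfig V | ∀ s ∈ ({x, u} : Set V), ∀ t ∈ Y, ¬ (openGraph ω).Reachable s t},
      (prodBernoulli w).real {ω : BondConfig V | ∀ s ∈ ({x, u} : Set V), ∀ t ∈ insert o Y, ¬ (openGraph ω).Reachable s t};
      (prodBernoulli w).real {ω : BondConfig V | ∀ s ∈ ({x, u, v} : Set V), ∀ t ∈ insert v Y, ¬ (openGraph ω).Reachable s t},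
      (prodBernoulli w).real {ω : BondConfig V | ∀ s ∈ ({x, u, v} : Set V), ∀ t ∈ Y, ¬ (openGraph ω).Reachable s t},
      (prodBernoulli w).real {ω : BondConfig V | ∀ s ∈ ({x, u, v} : Set V), ∀ t ∈ insert o Y,
        ¬ (openGraph ω).Reachable s t}] := by
  classical
  set μ := prodBernoulli w with hμ
  have hmeas : ∀ T : Set (BondConfig V), MeasurableSet T := fun _ => MeasurableSet.of_discrete
  -- the nine kernel entries, named
  set K1v := μ.real {ω : BondConfig V | ∀ s ∈ ({x} : Set V), ∀ t ∈ insert v Y, ¬ (openGraph ω).Reachable s t} with hK1v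
  set K1 := μ.real {ω : BondConfig V | ∀ s ∈ ({x} : Set V), ∀ t ∈ Y, ¬ (openGraph ω).Reachable s t} with hK1
  set K1o := μ.real {ω : BondConfig V | ∀ s ∈ ({x} : Set V), ∀ t ∈ insert o Y, ¬ (openGraph ω).Reachable s t} with hK1o
  set K2v := μ.real {ω : BondConfig V | ∀ s ∈ ({x, u} : Set V), ∀ t ∈ insert v Y, ¬ (openGraph ω).Reachable s t} with hK2v
  set K2 := μ.real {ω : BondConfig V | ∀ s ∈ ({x, u} : Set V), ∀ t ∈ Y, ¬ (openGraph ω).Reachable s t} with hK2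
  set K2o := μ.real {ω : BondConfig V | ∀ s ∈ ({x, u} : Set V), ∀ t ∈ insert o Y, ¬ (openGraph ω).Reachable s t} with hK2o
  set K3v := μ.real {ω : BondConfig V | ∀ s ∈ ({x, u, v} : Set V), ∀ t ∈ insert v Y, ¬ (openGraph ω).Reachable s t}
    with hK3v
  set K3 := μ.real {ω : BondConfig V | ∀ s ∈ ({x, u, v} : Set V), ∀ t ∈ Y, ¬ (openGraph ω).Reachable s t} with hK3
  set K3o := μ.real {ω : BondConfig V | ∀ s ∈ ({x, u, v} : Set V), ∀ t ∈ insert o Y, ¬ (openGraph ω).Reachable s t}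
    with hK3o
  -- (0) `K(S₃, Y ∪ v) = 0`
  have hK3v0 : K3v = 0 := by
    have : {ω : BondConfig V | ∀ s ∈ ({x, u, v} : Set V), ∀ t ∈ insert v Y, ¬ (openGraph ω).Reachable s t} = ∅ := by
      ext ω
      simp only [mem_setOf_eq, mem_empty_iff_false, iff_false, not_forall, not_not]
      exact ⟨v, by simp, v, mem_insert _ _, SimpleGraph.Reachable.refl _⟩
    rw [hK3v, this]; simp
  -- (1) the `R`'s
  have hR1 : μ.real {ω : BondConfig V | ∀ y ∈ Y, ¬ (openGraph ω).Reachable x y} = K1 := by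
    rw [hK1]; congr 1; ext ω; simp
  have hR2 : μ.real {ω : BondConfig V | ∀ y ∈ Y, ¬ (openGraph ω).Reachable x y ∧ ¬ (openGraph ω).Reachable u y} = K2 := by
    rw [hK2]; congr 1; ext ω
    simp only [mem_setOf_eq, mem_insert_iff, mem_singleton_iff, forall_eq_or_imp, forall_eq]
    exact ⟨fun h => ⟨fun t ht => (h t ht).1, fun t ht => (h t ht).2⟩, fun h t ht => ⟨h.1 t ht, h.2 t ht⟩⟩
  have hR3 : μ.real {ω : BondConfig V | ∀ y ∈ Y, ¬ (openGraph ω).Reachable x y ∧ ¬ (openGraph ω).Reachable u y ∧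
      ¬ (openGraph ω).Reachable v y} = K3 := by
    rw [hK3]; congr 1; ext ω
    simp only [mem_setOf_eq, mem_insert_iff, mem_singleton_iff, forall_eq_or_imp, forall_eq]
    exact ⟨fun h => ⟨fun t ht => (h t ht).1, fun t ht => (h t ht).2.1, fun t ht => (h t ht).2.2⟩,
      fun h t ht => ⟨h.1 t ht, h.2.1 t ht, h.2.2 t ht⟩⟩
  -- (2) the `N`'s
  have hN1 : μ.real ({ω : BondConfig V | ∀ y ∈ Y, ¬ (openGraph ω).Reachable x y} ∩
      {ω | ¬ (openGraph ω).Reachable x v}) = K1v := by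
    rw [hK1v]; congr 1; ext ω
    simp only [mem_inter_iff, mem_setOf_eq, mem_insert_iff, mem_singleton_iff, forall_eq_or_imp, forall_eq]
    tauto
  have hN2 : μ.real ({ω : BondConfig V | ∀ y ∈ Y, ¬ (openGraph ω).Reachable x y ∧ ¬ (openGraph ω).Reachable u y} ∩
      {ω | ¬ (openGraph ω).Reachable x v ∧ ¬ (openGraph ω).Reachable u v}) = K2v := by
    rw [hK2v]; congr 1; ext ω
    simp only [mem_inter_iff, mem_setOf_eq, mem_insert_iff, mem_singleton_iff, forall_eq_or_imp, forall_eq]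
    constructor
    · rintro ⟨h, hxv, huv⟩
      exact ⟨⟨hxv, fun t ht => (h t ht).1⟩, huv, fun t ht => (h t ht).2⟩
    · rintro ⟨⟨hxv, hx⟩, huv, hu⟩
      exact ⟨fun t ht => ⟨hx t ht, hu t ht⟩, hxv, huv⟩
  -- (3) the `A`'s as differences
  have hA1 : μ.real ({ω : BondConfig V | ∀ y ∈ Y, ¬ (openGraph ω).Reachable x y} ∩ openConn x o) = K1 - K1o := by
    have hsub : {ω : BondConfig V | ∀ s ∈ ({x} : Set V), ∀ t ∈ insert o Y, ¬ (openGraph ω).Reachable s t} ⊆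
        {ω : BondConfig V | ∀ s ∈ ({x} : Set V), ∀ t ∈ Y, ¬ (openGraph ω).Reachable s t} := by
      intro ω h; simp only [mem_setOf_eq] at h ⊢
      exact fun s hs t ht => h s hs t (mem_insert_of_mem _ ht)
    have hdiff : {ω : BondConfig V | ∀ s ∈ ({x} : Set V), ∀ t ∈ Y, ¬ (openGraph ω).Reachable s t} \
        {ω : BondConfig V | ∀ s ∈ ({x} : Set V), ∀ t ∈ insert o Y, ¬ (openGraph ω).Reachable s t} =
        {ω : BondConfig V | ∀ y ∈ Y, ¬ (openGraph ω).Reachable x y} ∩ openConn x o := by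
      ext ω
      simp only [mem_sdiff, mem_setOf_eq, mem_singleton_iff, forall_eq, mem_insert_iff, forall_eq_or_imp,
        mem_inter_iff]
      constructor
      · rintro ⟨h1, h2⟩
        refine ⟨h1, ?_⟩
        by_contra hxo
        exact h2 ⟨hxo, h1⟩
      · rintro ⟨h1, hxo⟩
        exact ⟨h1, fun h => h.1 hxo⟩
    rw [← hdiff, measureReal_sdiff hsub (hmeas _), hK1, hK1o]
  have hA2 : μ.real ({ω : BondConfig V | ∀ y ∈ Y, ¬ (openGraph ω).Reachable x y ∧ ¬ (openGraph ω).Reachable u y} ∩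
      (openConn x o ∪ openConn u o)) = K2 - K2o := by
    have hsub : {ω : BondConfig V | ∀ s ∈ ({x, u} : Set V), ∀ t ∈ insert o Y, ¬ (openGraph ω).Reachable s t} ⊆
        {ω : BondConfig V | ∀ s ∈ ({x, u} : Set V), ∀ t ∈ Y, ¬ (openGraph ω).Reachable s t} := by
      intro ω h; simp only [mem_setOf_eq] at h ⊢
      exact fun s hs t ht => h s hs t (mem_insert_of_mem _ ht)
    have hdiff : {ω : BondConfig V | ∀ s ∈ ({x, u} : Set V), ∀ t ∈ Y, ¬ (openGraph ω).Reachable s t} \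
        {ω : BondConfig V | ∀ s ∈ ({x, u} : Set V), ∀ t ∈ insert o Y, ¬ (openGraph ω).Reachable s t} =
        {ω : BondConfig V | ∀ y ∈ Y, ¬ (openGraph ω).Reachable x y ∧ ¬ (openGraph ω).Reachable u y} ∩
          (openConn x o ∪ openConn u o) := by
      ext ω
      simp only [mem_sdiff, mem_setOf_eq, mem_insert_iff, mem_singleton_iff, forall_eq_or_imp, forall_eq,
        mem_inter_iff, mem_union]
      constructor
      · rintro ⟨⟨hx, hu⟩, h2⟩
        refine ⟨fun t ht => ⟨hx t ht, hu t ht⟩, ?_⟩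
        by_contra hno
        exact h2 ⟨⟨fun hxo => hno (Or.inl hxo), hx⟩, fun huo => hno (Or.inr huo), hu⟩
      · rintro ⟨h1, hor⟩
        refine ⟨⟨fun t ht => (h1 t ht).1, fun t ht => (h1 t ht).2⟩, fun h => ?_⟩
        rcases hor with hxo | huo
        · exact h.1.1 hxo
        · exact h.2.1 huo
    rw [← hdiff, measureReal_sdiff hsub (hmeas _), hK2, hK2o]
  have hA3 : μ.real ({ω : BondConfig V | ∀ y ∈ Y, ¬ (openGraph ω).Reachable x y ∧ ¬ (openGraph ω).Reachable u y ∧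
      ¬ (openGraph ω).Reachable v y} ∩ (openConn x o ∪ openConn u o ∪ openConn v o)) = K3 - K3o := by
    have hsub : {ω : BondConfig V | ∀ s ∈ ({x, u, v} : Set V), ∀ t ∈ insert o Y, ¬ (openGraph ω).Reachable s t} ⊆
        {ω : BondConfig V | ∀ s ∈ ({x, u, v} : Set V), ∀ t ∈ Y, ¬ (openGraph ω).Reachable s t} := by
      intro ω h; simp only [mem_setOf_eq] at h ⊢
      exact fun s hs t ht => h s hs t (mem_insert_of_mem _ ht)
    have hdiff : {ω : BondConfig V | ∀ s ∈ ({x, u, v} : Set V), ∀ t ∈ Y, ¬ (openGraph ω).Reachable s t} \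
        {ω : BondConfig V | ∀ s ∈ ({x, u, v} : Set V), ∀ t ∈ insert o Y, ¬ (openGraph ω).Reachable s t} =
        {ω : BondConfig V | ∀ y ∈ Y, ¬ (openGraph ω).Reachable x y ∧ ¬ (openGraph ω).Reachable u y ∧
          ¬ (openGraph ω).Reachable v y} ∩ (openConn x o ∪ openConn u o ∪ openConn v o) := by
      ext ω
      simp only [mem_sdiff, mem_setOf_eq, mem_insert_iff, mem_singleton_iff, forall_eq_or_imp, forall_eq,
        mem_inter_iff, mem_union]
      constructor
      · rintro ⟨⟨hx, hu, hv⟩, h2⟩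
        refine ⟨fun t ht => ⟨hx t ht, hu t ht, hv t ht⟩, ?_⟩
        by_contra hno
        exact h2 ⟨⟨fun hxo => hno (Or.inl (Or.inl hxo)), hx⟩, ⟨fun huo => hno (Or.inl (Or.inr huo)), hu⟩,
          fun hvo => hno (Or.inr hvo), hv⟩
      · rintro ⟨h1, hor⟩
        refine ⟨⟨fun t ht => (h1 t ht).1, fun t ht => (h1 t ht).2.1, fun t ht => (h1 t ht).2.2⟩, fun h => ?_⟩
        rcases hor with (hxo | huo) | hvo
        · exact h.1.1 hxo
        · exact h.2.1.1 huo
        · exact h.2.2.1 hvo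
    rw [← hdiff, measureReal_sdiff hsub (hmeas _), hK3, hK3o]
  rw [hR1, hR2, hR3, hN1, hN2, hA1, hA2, hA3, Matrix.det_fin_three]
  simp only [Matrix.of_apply, Matrix.cons_val', Matrix.cons_val_zero, Matrix.cons_val_one, Matrix.cons_val_two,
    Matrix.empty_val', Matrix.cons_val_fin_one, Matrix.head_cons, Matrix.tail_cons, Matrix.head_fin_const, hK3v0]
  ring

/-- **The single-edge chain rule is the nonnegativity of a `3 × 3` minor of the disconnection kernel.**
`Consts.SingleEdgeChainRule` holds iff for every finite weighted graph on `Fin n` and all `x, u, v, o, Y`,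
`0 ≤ det [μ{S_i ↮ T_j}]` with rows `({x}, {x,u}, {x,u,v})` and columns `(Y ∪ {v}, Y, Y ∪ {o})`.
[cite: VandenbergHaggstromKahn2005, Thm. 1.1 (pp. 3–5)] -/
theorem singleEdgeChainRule_iff_det_nonneg :
    SingleEdgeChainRule ↔
      ∀ (n : ℕ) (w : Sym2 (Fin n) → unitInterval) (x u v o : Fin n) (Y : Set (Fin n)),
        0 ≤ Matrix.det !![
          (prodBernoulli w).real {ω : BondConfig (Fin n) | ∀ s ∈ ({x} : Set (Fin n)), ∀ t ∈ insert v Y,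
            ¬ (openGraph ω).Reachable s t},
          (prodBernoulli w).real {ω : BondConfig (Fin n) | ∀ s ∈ ({x} : Set (Fin n)), ∀ t ∈ Y,
            ¬ (openGraph ω).Reachable s t},
          (prodBernoulli w).real {ω : BondConfig (Fin n) | ∀ s ∈ ({x} : Set (Fin n)), ∀ t ∈ insert o Y,
            ¬ (openGraph ω).Reachable s t};
          (prodBernoulli w).real {ω : BondConfig (Fin n) | ∀ s ∈ ({x, u} : Set (Fin n)), ∀ t ∈ insert v Y,
            ¬ (openGraph ω).Reachable s t},
          (prodBernoulli w).real {ω : BondConfig (Fin n) | ∀ s ∈ ({x, u} : Set (Fin n)), ∀ t ∈ Y,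
            ¬ (openGraph ω).Reachable s t},
          (prodBernoulli w).real {ω : BondConfig (Fin n) | ∀ s ∈ ({x, u} : Set (Fin n)), ∀ t ∈ insert o Y,
            ¬ (openGraph ω).Reachable s t};
          (prodBernoulli w).real {ω : BondConfig (Fin n) | ∀ s ∈ ({x, u, v} : Set (Fin n)), ∀ t ∈ insert v Y,
            ¬ (openGraph ω).Reachable s t},
          (prodBernoulli w).real {ω : BondConfig (Fin n) | ∀ s ∈ ({x, u, v} : Set (Fin n)), ∀ t ∈ Y,
            ¬ (openGraph ω).Reachable s t},
          (prodBernoulli w).real {ω : BondConfig (Fin n) | ∀ s ∈ ({x, u, v} : Set (Fin n)), ∀ t ∈ insert o Y,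
            ¬ (openGraph ω).Reachable s t}] := by
  unfold SingleEdgeChainRule
  refine forall_congr' fun n => forall_congr' fun w => forall_congr' fun x => forall_congr' fun u =>
    forall_congr' fun v => forall_congr' fun o => forall_congr' fun Y => ?_
  rw [← singleEdgeChainRule_slack_eq_det w x u v o Y]
  exact sub_nonneg.symm

end Consts

end Summit.CriticalPhenomena.PercolationContinuityZ3.Theorems

end
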